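import Literature.AlgebraicGeometry.Modules.HomologySheafSections
import Literature.AlgebraicGeometry.Modules.DerivedPushforwardAcyclicResolution
import HarnessLib

/-!
# Sections of the cohomology sheaves of a bounded-below `Γ`-acyclic complex with quasi-coherent cohomology
# over an affine open: `Γ(V, 𝓗ʲ(I•)) = Hʲ(Γ(V, I•))` (Görtz–Wedhorn II, Cor. 21.46 + Thm. 22.2, proof of Lemma 22.36)

For a scheme `X` and a bounded-below cochain complex `K` of `𝒪_X`-modules (`K.IsStrictlyGE a`) whose
TERMS are acyclic on the affine opens (`Modules/PushforwardAcyclicResolution.IsAcyclicOn (K.X i) V` for every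
affine open `V`, `Hⁿ⁺¹(V, Kⁱ) = 0` — e.g. injective modules `IsAcyclicOn.of_injective`, flasque modules) and
whose COHOMOLOGY SHEAVES `𝓗ʲ(K) = K.homology j` are affine-localizing (the tree's section-level
quasi-coherence, `Modules/AffineLocalizing`; `= IsQuasicoherent` by `Modules/QuasicoherentAbelian`), this file
proves that over an AFFINE open `V` the sections of the cohomology sheaves are the cohomology of the sections:

* §1 **`isAcyclicOn_cycles`, `isAcyclicOn_kernel_toCycles`, `isAcyclicOn_image_toCycles`** — the cycle
  sheaves `Zʲ = K.cycles j`, and the kernels / images of `Kⁱ → Zⁱ⁺¹` (`K.toCycles i (i+1)`; image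
  `= Bⁱ⁺¹`), are acyclic on every affine open: dimension shifting along the short exact sequences
  `0 → Zⁱ → Kⁱ → Bⁱ⁺¹ → 0` and `0 → Bⁱ⁺¹ → Zⁱ⁺¹ → 𝓗ⁱ⁺¹ → 0` (`Morphisms.shortExact_kernel_factorThruImage`,
  `shortExact_imageι_cokernelπ`), starting from `Zⁱ = 0` below the bound, with Serre's vanishing
  `Hⁿ⁺¹(V, 𝓗ʲ) = 0` on affine `V` (`IsAcyclicOn.of_isAffineLocalizing`, Görtz–Wedhorn II Thm. 22.2) and the
  closure of acyclicity under extensions and cokernels of monomorphisms (`IsAcyclicOn.of_shortExact₂∕₃`);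
* §2 cokernels and homology on sections under ACYCLICITY hypotheses (the analogue of
  `Modules/HomologySheafSections` §1, §3 with «terms quasi-coherent» replaced by «kernel ∕ image acyclic»):
  `cokernel_π_app_surjective_of_isAcyclicOn`, `cokernel_π_app_eq_zero_iff_of_isAcyclicOn`, the cofork
  transports, `homologyπ_app_surjective_of_isAcyclicOn`, `homologyπ_app_eq_zero_iff_of_isAcyclicOn`;
* §3 **`homologyπ_app_surjective_of_isAcyclicOn_X`, `homologyπ_app_eq_zero_iff_of_isAcyclicOn_X`** — for `K`
  as above and `V` affine, `Γ(V, Zʲ) → Γ(V, 𝓗ʲ(K))` is SURJECTIVE and its kernel is the image of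
  `Γ(V, Kʲ⁻¹) → Γ(V, Zʲ)`; with `iCycles_app_injective` ∕ `exists_iCycles_app_eq` (`Γ(V, Zʲ) = ker Γ(V, dʲ)`,
  every open, `Modules/HomologySheafSections`) this says **`Γ(V, 𝓗ʲ(K)) = Hʲ(Γ(V, K•))`**: the
  hypercohomology spectral sequence `E₂^{p,q} = Hᵖ(V, 𝓗^q(K)) ⇒ H^{p+q}(V, K)` (Görtz–Wedhorn II Cor. 21.46)
  degenerates on the affine `V` (Thm. 22.2), the step `R⁰Γ(X, E) = Γ(X, H⁰(E))` of the proof of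
  Görtz–Wedhorn II Lemma 22.36 (`D(R) ≃ D_qcoh(Spec R)`), here for bounded-below complexes and without
  spectral sequences.

Everything is PROVED; 0 named facts; no definitions, no instances. Written for the Stage I comparison
«`D⁺_qc(Mod 𝒪_X)` objects are classes of complexes of quasi-coherent modules» (Hartshorne, *Residues and
Duality*, II Cor. 7.19) on its affine critical path; nothing here bears on any summit statement. Typed for the
cell `pub-hodge-ring2` — a research route conditional on HC_CM, not a corollary; nothing in this file refers to it.

## References

* U. Görtz, T. Wedhorn, *Algebraic Geometry II: Cohomology of Schemes*, Springer Spektrum (2023): Cor. 21.46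
  (hypercohomology spectral sequence, p. 245), Thm. 22.2 (p. 328), Lemma 22.36 and its proof (pp. 349–350).
  [GortzWedhorn2023]
* R. Hartshorne, *Residues and Duality*, LNM 20 (1966), II Cor. 7.19 (p. 133). [HartshorneRD1966]
* R. Hartshorne, *Algebraic Geometry*, GTM 52 (1977), III Prop. 1.2A, III Prop. 8.5 (p. 251). [Hartshorne1977]
* The Stacks Project, Tag 01XB. [StacksProject]
-/

noncomputable section

-- `TopCat.Presheaf`/`Scheme.Modules` are not reducible (as in Mathlib's `AlgebraicGeometry/Modules/Sheaf.lean`).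
set_option backward.isDefEq.respectTransparency false

open CategoryTheory CategoryTheory.Limits AlgebraicGeometry TopologicalSpace Opposite

universe u

namespace Literature.AlgebraicGeometry.Modules

open Literature.AlgebraicGeometry.Morphisms

variable {X : Scheme.{u}}

/-! ## §1 Dimension shifting: cycles and boundaries of a `Γ`-acyclic complex with quasi-coherent cohomology
are acyclic on affine opens -/

section General

variable {ι : Type*} {c : ComplexShape ι} (K : HomologicalComplex X.Modules c)

/-- The kernel of `Kⁱ → Zʲ` (`K.toCycles i j`, `c.next i = j`) is the cycle module `Zⁱ` (`Zʲ ↪ Kʲ` is a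
monomorphism and `Zⁱ = ker dⁱ`). [cite: Hartshorne1977, III §1 p. 203 (cycles and homology of a complex)] -/
theorem nonempty_kernel_toCycles_iso_cycles (i j : ι) (hij : c.next i = j) :
    Nonempty (kernel (K.toCycles i j) ≅ K.cycles i) :=
  ⟨(kernelCompMono (K.toCycles i j) (K.iCycles j)).symm ≪≫ kernelIsoOfEq (K.toCycles_i i j) ≪≫
    ((K.cyclesIsKernel i j hij).conePointUniqueUpToIso (kernelIsKernel (K.d i j))).symm⟩

/-- The cokernel of `Kⁱ → Zʲ` (`K.toCycles i j`, `c.prev j = i`) is the homology module `𝓗ʲ(K)`.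
[cite: Hartshorne1977, III §1 p. 203 (cycles and homology of a complex)] -/
theorem nonempty_cokernel_toCycles_iso_homology (i j : ι) (hij : c.prev j = i) :
    Nonempty (cokernel (K.toCycles i j) ≅ K.homology j) :=
  ⟨(cokernelIsCokernel _).coconePointUniqueUpToIso (K.homologyIsCokernel i j hij)⟩

/-- A cycle module of a zero term is zero. [cite: Hartshorne1977, III §1 p. 203 (cycles and homology of a complex)] -/
theorem isZero_cycles_of_isZero_X (i : ι) (h : IsZero (K.X i)) : IsZero (K.cycles i) :=
  IsZero.of_mono (K.iCycles i) h

variable {K}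

/-- **One step of the dimension shifting.** If `Zⁱ` and `Kⁱ` are acyclic on the open `V` and `𝓗ʲ(K)`
(`c.next i = j`, `c.prev j = i`) is acyclic on `V`, then so are the kernel and the image `Bʲ` of `Kⁱ → Zʲ`, and
`Zʲ` (along `0 → Zⁱ → Kⁱ → Bʲ → 0` and `0 → Bʲ → Zʲ → 𝓗ʲ → 0`).
[cite: GortzWedhorn2023, proof of Lemma 22.36 (p. 350)] [cite: Hartshorne1977, III Prop. 1.2A] -/
theorem isAcyclicOn_cycles_step {i j : ι} (hij : c.next i = j) (hji : c.prev j = i) {V : X.Opens}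
    (hZ : IsAcyclicOn (K.cycles i) V) (hX : IsAcyclicOn (K.X i) V) (hH : IsAcyclicOn (K.homology j) V) :
    IsAcyclicOn (kernel (K.toCycles i j)) V ∧ IsAcyclicOn (Abelian.image (K.toCycles i j)) V ∧
      IsAcyclicOn (K.cycles j) V := by
  obtain ⟨eZ⟩ := nonempty_kernel_toCycles_iso_cycles K i j hij
  obtain ⟨eH⟩ := nonempty_cokernel_toCycles_iso_homology K i j hji
  have hker : IsAcyclicOn (kernel (K.toCycles i j)) V := IsAcyclicOn.of_iso eZ.symm hZ
  have him : IsAcyclicOn (Abelian.image (K.toCycles i j)) V :=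
    IsAcyclicOn.of_shortExact₃ (shortExact_kernel_factorThruImage (K.toCycles i j)) V hker hX
  have hcoker : IsAcyclicOn (cokernel (K.toCycles i j)) V := IsAcyclicOn.of_iso eH.symm hH
  exact ⟨hker, him, IsAcyclicOn.of_shortExact₂ (shortExact_imageι_cokernelπ (K.toCycles i j)) V him hcoker⟩

end General

section Bounded

variable {K : CochainComplex X.Modules ℤ}
  (hK : ∀ (i : ℤ) ⦃V : X.Opens⦄, IsAffineOpen V → IsAcyclicOn (K.X i) V)
  (hH : ∀ (i : ℤ), IsAffineLocalizing (K.homology i)) (a : ℤ) [K.IsStrictlyGE a]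
include hK hH a

/-- **The cycle modules `Zⁱ` of a bounded-below `Γ`-acyclic complex with affine-localizing cohomology sheaves
are acyclic on every affine open** (`Hⁿ⁺¹(V, Zⁱ) = 0`): induction on `i` from `Zⁱ = 0` below the bound,
through `0 → Zⁱ → Kⁱ → Bⁱ⁺¹ → 0`, `0 → Bⁱ⁺¹ → Zⁱ⁺¹ → 𝓗ⁱ⁺¹ → 0` and Serre's vanishing for `𝓗ⁱ⁺¹` on the affine
`V`. [cite: GortzWedhorn2023, Cor. 21.46 (p. 245) and Thm. 22.2 (p. 328)] [cite: Hartshorne1977, III Prop. 1.2A] -/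
theorem isAcyclicOn_cycles (i : ℤ) ⦃V : X.Opens⦄ (hV : IsAffineOpen V) : IsAcyclicOn (K.cycles i) V := by
  -- below the bound everything vanishes
  have base : ∀ i : ℤ, i < a → IsAcyclicOn (K.cycles i) V := fun i hi =>
    IsAcyclicOn.of_isZero (isZero_cycles_of_isZero_X K i (K.isZero_of_isStrictlyGE a i hi)) V
  -- the inductive step
  have step : ∀ i : ℤ, IsAcyclicOn (K.cycles i) V → IsAcyclicOn (K.cycles (i + 1)) V := fun i hi =>
    (isAcyclicOn_cycles_step ((ComplexShape.up ℤ).next_eq' rfl) ((ComplexShape.up ℤ).prev_eq' rfl) hi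
      (hK i hV) (IsAcyclicOn.of_isAffineLocalizing (hH (i + 1)) hV)).2.2
  -- induction on `i - (a - 1)`
  have key : ∀ n : ℕ, IsAcyclicOn (K.cycles (a - 1 + n)) V := by
    intro n
    induction n with
    | zero => exact base _ (by simp)
    | succ n ih =>
      have e : a - 1 + ((n + 1 : ℕ) : ℤ) = a - 1 + n + 1 := by push_cast; ring
      rw [e]
      exact step _ ih
  by_cases hi : i < a
  · exact base i hi
  · have e : i = a - 1 + ((i - a + 1).toNat : ℤ) := by
      rw [Int.toNat_of_nonneg (by omega)]; ring
    rw [e]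
    exact key _

/-- The kernel of `Kⁱ → Zⁱ⁺¹` (`= Zⁱ`) is acyclic on every affine open.
[cite: GortzWedhorn2023, Cor. 21.46 (p. 245) and Thm. 22.2 (p. 328)] -/
theorem isAcyclicOn_kernel_toCycles (i : ℤ) ⦃V : X.Opens⦄ (hV : IsAffineOpen V) :
    IsAcyclicOn (kernel (K.toCycles i (i + 1))) V :=
  (isAcyclicOn_cycles_step ((ComplexShape.up ℤ).next_eq' rfl) ((ComplexShape.up ℤ).prev_eq' rfl)
    (isAcyclicOn_cycles hK hH a i hV) (hK i hV) (IsAcyclicOn.of_isAffineLocalizing (hH (i + 1)) hV)).1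

/-- **The boundary modules `Bⁱ⁺¹ = im(Kⁱ → Zⁱ⁺¹)` are acyclic on every affine open.**
[cite: GortzWedhorn2023, Cor. 21.46 (p. 245) and Thm. 22.2 (p. 328)] [cite: Hartshorne1977, III Prop. 1.2A] -/
theorem isAcyclicOn_image_toCycles (i : ℤ) ⦃V : X.Opens⦄ (hV : IsAffineOpen V) :
    IsAcyclicOn (Abelian.image (K.toCycles i (i + 1))) V :=
  (isAcyclicOn_cycles_step ((ComplexShape.up ℤ).next_eq' rfl) ((ComplexShape.up ℤ).prev_eq' rfl)
    (isAcyclicOn_cycles hK hH a i hV) (hK i hV) (IsAcyclicOn.of_isAffineLocalizing (hH (i + 1)) hV)).2.1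

end Bounded

/-! ## §2 Cokernels and homology on sections, under acyclicity of kernel and image -/

section Cokernel

variable {M N : X.Modules} (φ : M ⟶ N) {V : X.Opens}

/-- **`Γ(V, N) → Γ(V, coker φ)` is surjective when `H¹(V, im φ) = 0`** (long exact sequence of
`0 → im φ → N → coker φ → 0`). [cite: Hartshorne1977, III Prop. 1.2A] [cite: GortzWedhorn2023, Cor. 12.34 / (22.1) (p. 328)] -/
theorem cokernel_π_app_surjective_of_isAcyclicOn (h : IsAcyclicOn (Abelian.image φ) V) :
    Function.Surjective ((cokernel.π φ).app V) :=
  IsAcyclicOn.surjective_app_of_shortExact (shortExact_imageι_cokernelπ φ) V h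

/-- **The kernel of `Γ(V, N) → Γ(V, coker φ)` is the image of `Γ(V, M)` when `H¹(V, ker φ) = 0`** (left
exactness of sections on `0 → im φ → N → coker φ`, and surjectivity of `Γ(V, M) → Γ(V, im φ)` from the long
exact sequence of `0 → ker φ → M → im φ → 0`). [cite: Hartshorne1977, III Prop. 1.2A] [cite: Hartshorne1977, II Ex. 1.8 (p. 66)] -/
theorem cokernel_π_app_eq_zero_iff_of_isAcyclicOn (hker : IsAcyclicOn (kernel φ) V) (n : Γ(N, V)) :
    (cokernel.π φ).app V n = 0 ↔ ∃ m : Γ(M, V), φ.app V m = n := by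
  refine ⟨fun hn => ?_, ?_⟩
  · obtain ⟨i, hi⟩ := (sections_exact_of_shortExact (shortExact_imageι_cokernelπ φ) V).2 n hn
    obtain ⟨m, hm⟩ := IsAcyclicOn.surjective_app_of_shortExact (shortExact_kernel_factorThruImage φ) V hker i
    refine ⟨m, ?_⟩
    have hm' : (Abelian.factorThruImage φ).app V m = i := hm
    have hi' : (Abelian.image.ι φ).app V i = n := hi
    calc φ.app V m = (Abelian.factorThruImage φ ≫ Abelian.image.ι φ).app V m := by
          rw [Abelian.image.fac]
      _ = (Abelian.image.ι φ).app V ((Abelian.factorThruImage φ).app V m) := rfl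
      _ = n := by rw [hm', hi']
  · rintro ⟨m, rfl⟩
    exact app_app_eq_zero (ShortComplex.mk φ (cokernel.π φ) (cokernel.condition φ)) V m

variable {φ}

/-- Transport to an arbitrary colimit cokernel cofork: its projection is surjective on the sections over `V`
when `H¹(V, im φ) = 0`. [cite: Hartshorne1977, III Prop. 1.2A] -/
theorem Cofork.π_app_surjective_of_isColimit_of_isAcyclicOn {c : CokernelCofork φ} (hc : IsColimit c)
    (h : IsAcyclicOn (Abelian.image φ) V) : Function.Surjective (c.π.app V) := by
  let e : cokernel φ ≅ c.pt := (cokernelIsCokernel φ).coconePointUniqueUpToIso hc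
  have he : cokernel.π φ ≫ e.hom = c.π :=
    (cokernelIsCokernel φ).comp_coconePointUniqueUpToIso_hom hc WalkingParallelPair.one
  intro y
  obtain ⟨n, hn⟩ := cokernel_π_app_surjective_of_isAcyclicOn φ h (e.inv.app V y)
  refine ⟨n, ?_⟩
  rw [← he]
  change e.hom.app V ((cokernel.π φ).app V n) = y
  rw [hn, hom_app_inv_app]

/-- Transport to an arbitrary colimit cokernel cofork: when `H¹(V, ker φ) = 0`, a section over `V` dies under
the projection iff it comes from `Γ(V, M)`. [cite: Hartshorne1977, III Prop. 1.2A] -/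
theorem Cofork.π_app_eq_zero_iff_of_isColimit_of_isAcyclicOn {c : CokernelCofork φ} (hc : IsColimit c)
    (hker : IsAcyclicOn (kernel φ) V) (n : Γ(N, V)) : c.π.app V n = 0 ↔ ∃ m : Γ(M, V), φ.app V m = n := by
  let e : cokernel φ ≅ c.pt := (cokernelIsCokernel φ).coconePointUniqueUpToIso hc
  have he : cokernel.π φ ≫ e.hom = c.π :=
    (cokernelIsCokernel φ).comp_coconePointUniqueUpToIso_hom hc WalkingParallelPair.one
  rw [← cokernel_π_app_eq_zero_iff_of_isAcyclicOn φ hker n, ← he]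
  change e.hom.app V ((cokernel.π φ).app V n) = 0 ↔ _
  constructor
  · intro h
    have := congrArg (e.inv.app V) h
    rwa [inv_app_hom_app, map_zero] at this
  · intro h
    rw [h, map_zero]

end Cokernel

section Complex

variable {ι : Type*} {c : ComplexShape ι} (K : HomologicalComplex X.Modules c)

/-- **`Γ(V, Zʲ) → Γ(V, 𝓗ʲ(K))` is surjective when `H¹(V, Bʲ) = 0`** (`Bʲ = im(Kⁱ → Zʲ)`, `c.prev j = i`).
[cite: GortzWedhorn2023, proof of Lemma 22.36 (p. 350)] [cite: Hartshorne1977, III Prop. 8.5 (p. 251)] -/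
theorem homologyπ_app_surjective_of_isAcyclicOn (i j : ι) (hij : c.prev j = i) {V : X.Opens}
    (h : IsAcyclicOn (Abelian.image (K.toCycles i j)) V) : Function.Surjective ((K.homologyπ j).app V) :=
  Cofork.π_app_surjective_of_isColimit_of_isAcyclicOn (K.homologyIsCokernel i j hij) h

/-- **`Γ(V, 𝓗ʲ(K)) = Γ(V, Zʲ) / im(Γ(V, Kⁱ) → Γ(V, Zʲ))` when `H¹(V, ker(Kⁱ → Zʲ)) = 0`** (`c.prev j = i`): a
section of `Zʲ` over `V` dies in `Γ(V, 𝓗ʲ)` iff it is the image of a section of `Kⁱ`.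
[cite: GortzWedhorn2023, proof of Lemma 22.36 (p. 350)] [cite: Hartshorne1977, III Prop. 8.5 (p. 251)] -/
theorem homologyπ_app_eq_zero_iff_of_isAcyclicOn (i j : ι) (hij : c.prev j = i) {V : X.Opens}
    (hker : IsAcyclicOn (kernel (K.toCycles i j)) V) (z : Γ(K.cycles j, V)) :
    (K.homologyπ j).app V z = 0 ↔ ∃ x : Γ(K.X i, V), (K.toCycles i j).app V x = z :=
  Cofork.π_app_eq_zero_iff_of_isColimit_of_isAcyclicOn (K.homologyIsCokernel i j hij) hker z

end Complex

/-! ## §3 `Γ(V, 𝓗ʲ(K)) = Hʲ(Γ(V, K•))` on an affine open for a bounded-below `Γ`-acyclic complex with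
quasi-coherent cohomology -/

section Affine

variable {K : CochainComplex X.Modules ℤ}
  (hK : ∀ (i : ℤ) ⦃V : X.Opens⦄, IsAffineOpen V → IsAcyclicOn (K.X i) V)
  (hH : ∀ (i : ℤ), IsAffineLocalizing (K.homology i)) (a : ℤ) [K.IsStrictlyGE a]
include hK hH a

/-- **`Γ(V, Zʲ) → Γ(V, 𝓗ʲ(K))` is SURJECTIVE on an AFFINE open `V`** for a bounded-below complex `K` of
`𝒪_X`-modules with `Γ`-acyclic terms (on affine opens; e.g. injective or flasque) and affine-localizing
cohomology sheaves — the degeneration `Hʲ(V, K) ↠ H⁰(V, 𝓗ʲ(K))` of the hypercohomology spectral sequence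
on an affine. [cite: GortzWedhorn2023, Cor. 21.46 (p. 245), Thm. 22.2 (p. 328), proof of Lemma 22.36 (p. 350)]
[cite: Hartshorne1977, III Prop. 8.5 (p. 251)] -/
theorem homologyπ_app_surjective_of_isAcyclicOn_X (j : ℤ) ⦃V : X.Opens⦄ (hV : IsAffineOpen V) :
    Function.Surjective ((K.homologyπ j).app V) := by
  have h := isAcyclicOn_image_toCycles hK hH a (j - 1) hV
  rw [sub_add_cancel] at h
  exact homologyπ_app_surjective_of_isAcyclicOn K (j - 1) j (by simp) h

/-- **`Γ(V, 𝓗ʲ(K)) = Γ(V, Zʲ) / im(Γ(V, Kʲ⁻¹) → Γ(V, Zʲ))` on an AFFINE open `V`** for a bounded-below complex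
`K` of `𝒪_X`-modules with `Γ`-acyclic terms and affine-localizing cohomology sheaves: a section of `Zʲ` over
`V` dies in `Γ(V, 𝓗ʲ(K))` iff it is `dʲ⁻¹` of a section of `Kʲ⁻¹`. Together with
`homologyπ_app_surjective_of_isAcyclicOn_X` and `iCycles_app_injective` ∕ `exists_iCycles_app_eq`
(`Γ(V, Zʲ) = ker Γ(V, dʲ)`) this is **`Γ(V, 𝓗ʲ(K)) = Hʲ(Γ(V, K•))`**, i.e. `Hʲ(V, E) = Γ(V, 𝓗ʲ(E))` for
`E ∈ D⁺_qc` on an affine `V`. [cite: GortzWedhorn2023, Cor. 21.46 (p. 245), Thm. 22.2 (p. 328), proof of Lemma 22.36 (p. 350)]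
[cite: Hartshorne1977, III Prop. 8.5 (p. 251)] -/
theorem homologyπ_app_eq_zero_iff_of_isAcyclicOn_X (j : ℤ) ⦃V : X.Opens⦄ (hV : IsAffineOpen V)
    (z : Γ(K.cycles j, V)) :
    (K.homologyπ j).app V z = 0 ↔ ∃ x : Γ(K.X (j - 1), V), (K.toCycles (j - 1) j).app V x = z := by
  have h := isAcyclicOn_kernel_toCycles hK hH a (j - 1) hV
  rw [sub_add_cancel] at h
  exact homologyπ_app_eq_zero_iff_of_isAcyclicOn K (j - 1) j (by simp) h z

/-- **`Γ(V, Kʲ⁻¹) → Γ(V, Bʲ)` is surjective on an AFFINE open `V`** (`Bʲ = im(Kʲ⁻¹ → Zʲ)`; `H¹(V, Zʲ⁻¹) = 0`)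
for a bounded-below `Γ`-acyclic complex with affine-localizing cohomology sheaves.
[cite: GortzWedhorn2023, proof of Lemma 22.36 (p. 350)] [cite: Hartshorne1977, III Prop. 1.2A] -/
theorem factorThruImage_toCycles_app_surjective (j : ℤ) ⦃V : X.Opens⦄ (hV : IsAffineOpen V) :
    Function.Surjective ((Abelian.factorThruImage (K.toCycles (j - 1) j)).app V) := by
  have h := isAcyclicOn_kernel_toCycles hK hH a (j - 1) hV
  rw [sub_add_cancel] at h
  exact IsAcyclicOn.surjective_app_of_shortExact (shortExact_kernel_factorThruImage (K.toCycles (j - 1) j)) V h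

end Affine

section Injective

variable {K : CochainComplex X.Modules ℤ} [hI : ∀ i, Injective (K.X i)]
  (hH : ∀ (i : ℤ), IsAffineLocalizing (K.homology i)) (a : ℤ) [K.IsStrictlyGE a]
include hH a

/-- **Injective case** (Hartshorne III.2.4–2.5: injective `𝒪_X`-modules are flasque, hence acyclic on every
open): for a bounded-below complex `I•` of injective `𝒪_X`-modules with affine-localizing cohomology sheaves
and an affine open `V`, `Γ(V, Zʲ) → Γ(V, 𝓗ʲ(I•))` is surjective with kernel the image of `Γ(V, Iʲ⁻¹)`.
[cite: GortzWedhorn2023, proof of Lemma 22.36 (p. 350)] [cite: Hartshorne1977, III Prop. 8.5 (p. 251)] -/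
theorem homologyπ_app_surjective_of_injective (j : ℤ) ⦃V : X.Opens⦄ (hV : IsAffineOpen V) :
    Function.Surjective ((K.homologyπ j).app V) ∧
      ∀ z : Γ(K.cycles j, V), (K.homologyπ j).app V z = 0 ↔
        ∃ x : Γ(K.X (j - 1), V), (K.toCycles (j - 1) j).app V x = z :=
  have hK : ∀ (i : ℤ) ⦃V : X.Opens⦄, IsAffineOpen V → IsAcyclicOn (K.X i) V :=
    fun i V _ => IsAcyclicOn.of_injective (K.X i) V
  ⟨homologyπ_app_surjective_of_isAcyclicOn_X hK hH a j hV,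
    fun z => homologyπ_app_eq_zero_iff_of_isAcyclicOn_X hK hH a j hV z⟩

end Injective

end Literature.AlgebraicGeometry.Modules

end
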